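import Summits.NavierStokesRegularity.NavierStokesRegularity.Theorems.HubbleDynamoNoSelfExcitedDynamoStubRecurrentProfile
import Summits.NavierStokesRegularity.NavierStokesRegularity.Theorems.HubbleDynamoNoSelfExcitedDynamoNoTypeIProfile
import Summits.NavierStokesRegularity.NavierStokesRegularity.Theorems.HubbleDynamoNoSelfExcitedDynamoNoTypeIProfileConverse
import HarnessLib

/-!
# Crux `NoSelfExcitedDynamo` (stmt-NavierStokesRegularity-1934), line `registered` v9: the crux IS the
  non-existence of RECURRENT pointwise-Type-I profile flows ("no Type-I quasi-breathers")

Theorems file (lands `--supports stmt-NavierStokesRegularity-1934`; registered sub-goals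
`eternalLiouville_of_noRecurrentTypeIProfile`, `noSelfExcitedDynamo_of_noRecurrentTypeIProfile`,
`noRecurrentTypeIProfile_of_noSelfExcitedDynamo`, `noRecurrentTypeIProfile_iff_noTypeIProfile`). It makes
durable the closed composition of the lead's skeleton v9 (`Cruxes/NoSelfExcitedDynamo/Lines/birth.lean`)
and records the EQUIVALENCES

  `NoSelfExcitedDynamo` ⇔ (G) every eternal profile-class solution of Leray's backward system dips below
  every `δ > 0` at some time (⇔ switches off; file `…NoTypeIProfileConverse.lean`)
  ⇔ (G′) every RECURRENT eternal profile-class solution (recurrent along integer similarity times,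
  uniformly on compacts of `ℝ × ℝ³`) vanishes identically.

(G′) contains the Liouville problems for backward self-similar, rotated self-similar, discretely
self-similar and rotated discretely self-similar Type-I profiles with ALL parameters (the "breathers"
of Pineau–Vicol 2026, Rmk 1.8), and for almost-periodic profile flows.

* `eternalLiouville_of_noRecurrentTypeIProfile`: (G′) ⇒ every eternal profile-class solution vanishes
  (`stub_pastSmallnessLiouville` p156442 unless an amplitude floor persists in the remote past; then
  `stub_recurrentProfile` realises the floor by a RECURRENT eternal flow, which (G′) kills).
* `noSelfExcitedDynamo_of_noRecurrentTypeIProfile`: (G′) ⇒ crux (`stub_eternalReduction` p151325).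
* `noRecurrentTypeIProfile_of_noSelfExcitedDynamo`: crux ⇒ (G′) (the crux kills every eternal
  profile-class solution: `stub_eternalLiouvilleOfCrux` p152276 + `eternalLiouville_of_switchOff` p155533).
* `noRecurrentTypeIProfile_iff_noTypeIProfile`: (G′) ⇔ (G).
-/

noncomputable section

-- the mandated stub namespace repeats `NavierStokesRegularity` (tree precedent for this crux's stubs)
set_option linter.dupNamespace false

namespace Summit.NavierStokesRegularity.NavierStokesRegularity.Theorems.NoSelfExcitedDynamo.Registered

open Set MeasureTheory Filter Topology Metric
open scoped ContDiff
open Literature.Analysis.FluidPDE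

/-- **Eternal Liouville from the non-existence of recurrent Type-I profiles** (registered sub-goal
`eternalLiouville_of_noRecurrentTypeIProfile`): if every recurrent eternal profile-class solution of
Leray's backward system vanishes, then EVERY eternal profile-class solution vanishes. If the amplitude
of `U` is `δ`-small at arbitrarily early times for every `δ > 0`, `stub_pastSmallnessLiouville`
applies; otherwise some `δ > 0` is an amplitude floor on a past half-line, `stub_recurrentProfile`
realises it at every time by a recurrent eternal profile-class `W`, and the hypothesis makes `W ≡ 0` —
contradicting the floor at time `0`. -/
theorem eternalLiouville_of_noRecurrentTypeIProfile :
    (∀ (W : ℝ → EuclideanSpace ℝ (Fin 3) → EuclideanSpace ℝ (Fin 3)) (Q : ℝ → EuclideanSpace ℝ (Fin 3) → ℝ),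
      IsBackwardLeraySolutionOn univ 1 W Q →
      (∀ k : ℕ, ∃ K : ℝ, ∀ s y, (1 + ‖y‖) ^ (k + 1) * ‖iteratedFDeriv ℝ k (W s) y‖ ≤ K) →
      (∀ ε : ℝ, 0 < ε → ∀ (R : ℝ) (N : ℕ), ∃ n : ℕ, N ≤ n ∧
        ∀ s ∈ Icc (-R) R, ∀ y ∈ Metric.closedBall (0 : EuclideanSpace ℝ (Fin 3)) R,
          ‖W (s + n) y - W s y‖ < ε) →
      ∀ s y, W s y = 0) →
    ∀ (U : ℝ → EuclideanSpace ℝ (Fin 3) → EuclideanSpace ℝ (Fin 3)) (P : ℝ → EuclideanSpace ℝ (Fin 3) → ℝ),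
      IsBackwardLeraySolutionOn univ 1 U P →
      (∀ k : ℕ, ∃ K : ℝ, ∀ s y, (1 + ‖y‖) ^ (k + 1) * ‖iteratedFDeriv ℝ k (U s) y‖ ≤ K) →
      ∀ s y, U s y = 0 := by
  intro hG U P hL hprof
  refine stub_pastSmallnessLiouville U P hL hprof fun δ hδ S => ?_
  by_contra hcon
  push Not at hcon
  obtain ⟨W, Q, hW, hWprof, hfloor, hrec⟩ :=
    stub_recurrentProfile U P hL hprof δ S hδ fun s hs => (hcon s hs).imp fun y hy => hy.le
  obtain ⟨y, hy⟩ := hfloor 0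
  have h0 : W 0 y = 0 := hG W Q hW hWprof hrec 0 y
  rw [h0, norm_zero] at hy
  exact absurd hy (not_le.2 hδ)

/-- **The crux from the non-existence of recurrent Type-I profiles** (registered sub-goal
`noSelfExcitedDynamo_of_noRecurrentTypeIProfile`; the composition of the line's skeleton v9, made
durable): hypothesis (G′) implies `NoSelfExcitedDynamo` (conclusion written unfolded), by
`stub_eternalReduction` (p151325) and `eternalLiouville_of_noRecurrentTypeIProfile`. -/
theorem noSelfExcitedDynamo_of_noRecurrentTypeIProfile :
    (∀ (W : ℝ → EuclideanSpace ℝ (Fin 3) → EuclideanSpace ℝ (Fin 3)) (Q : ℝ → EuclideanSpace ℝ (Fin 3) → ℝ),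
      IsBackwardLeraySolutionOn univ 1 W Q →
      (∀ k : ℕ, ∃ K : ℝ, ∀ s y, (1 + ‖y‖) ^ (k + 1) * ‖iteratedFDeriv ℝ k (W s) y‖ ≤ K) →
      (∀ ε : ℝ, 0 < ε → ∀ (R : ℝ) (N : ℕ), ∃ n : ℕ, N ≤ n ∧
        ∀ s ∈ Icc (-R) R, ∀ y ∈ Metric.closedBall (0 : EuclideanSpace ℝ (Fin 3)) R,
          ‖W (s + n) y - W s y‖ < ε) →
      ∀ s y, W s y = 0) →
    ∀ u : ℝ → EuclideanSpace ℝ (Fin 3) → EuclideanSpace ℝ (Fin 3),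
      IsBoundedAncientMildSolution 1 u →
      (∀ t < 0, AEStronglyMeasurable (u t) volume) → (∃ C : ℝ, HasTypeIDecay C u) →
      ∀ t < 0, u t =ᵐ[volume] (0 : EuclideanSpace ℝ (Fin 3) → EuclideanSpace ℝ (Fin 3)) :=
  fun hG => stub_eternalReduction fun U P hL hprof _ =>
    eternalLiouville_of_noRecurrentTypeIProfile hG U P hL hprof

/-- **The crux implies (G′)** (registered sub-goal `noRecurrentTypeIProfile_of_noSelfExcitedDynamo`;
hypothesis `NoSelfExcitedDynamo` written unfolded): under the crux every eternal profile-class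
solution vanishes (`stub_eternalLiouvilleOfCrux` + `eternalLiouville_of_switchOff`), recurrent or not. -/
theorem noRecurrentTypeIProfile_of_noSelfExcitedDynamo :
    (∀ u : ℝ → EuclideanSpace ℝ (Fin 3) → EuclideanSpace ℝ (Fin 3),
      IsBoundedAncientMildSolution 1 u →
      (∀ t < 0, AEStronglyMeasurable (u t) volume) → (∃ C : ℝ, HasTypeIDecay C u) →
      ∀ t < 0, u t =ᵐ[volume] (0 : EuclideanSpace ℝ (Fin 3) → EuclideanSpace ℝ (Fin 3))) →
    ∀ (W : ℝ → EuclideanSpace ℝ (Fin 3) → EuclideanSpace ℝ (Fin 3)) (Q : ℝ → EuclideanSpace ℝ (Fin 3) → ℝ),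
      IsBackwardLeraySolutionOn univ 1 W Q →
      (∀ k : ℕ, ∃ K : ℝ, ∀ s y, (1 + ‖y‖) ^ (k + 1) * ‖iteratedFDeriv ℝ k (W s) y‖ ≤ K) →
      (∀ ε : ℝ, 0 < ε → ∀ (R : ℝ) (N : ℕ), ∃ n : ℕ, N ≤ n ∧
        ∀ s ∈ Icc (-R) R, ∀ y ∈ Metric.closedBall (0 : EuclideanSpace ℝ (Fin 3)) R,
          ‖W (s + n) y - W s y‖ < ε) →
      ∀ s y, W s y = 0 :=
  fun hcrux W Q hW hWprof _ =>
    eternalLiouville_of_switchOff (stub_eternalLiouvilleOfCrux hcrux) W Q hW hWprof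

/-- **(G′) ⇔ (G)** (registered sub-goal `noRecurrentTypeIProfile_iff_noTypeIProfile`): the two forms of
the line's open stub — "recurrent eternal profile flows vanish" and "every eternal profile flow dips
below every `δ > 0`" — are equivalent. (⇒) through the crux: (G′) ⇒ crux
(`noSelfExcitedDynamo_of_noRecurrentTypeIProfile`) ⇒ (G) (`noTypeIProfile_of_noSelfExcitedDynamo`,
p156662). (⇐) directly: a recurrent flow that dips below `ε₀` at time `s̄` obeys
`‖W(s + n)‖_∞ ≤ 2ε₀ e^{−(s+n−s̄)/2}` (`stub_singleTimeSwitchOff`, p156442) and returns to itself along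
`n → ∞`, so it vanishes. -/
theorem noRecurrentTypeIProfile_iff_noTypeIProfile :
    (∀ (W : ℝ → EuclideanSpace ℝ (Fin 3) → EuclideanSpace ℝ (Fin 3)) (Q : ℝ → EuclideanSpace ℝ (Fin 3) → ℝ),
      IsBackwardLeraySolutionOn univ 1 W Q →
      (∀ k : ℕ, ∃ K : ℝ, ∀ s y, (1 + ‖y‖) ^ (k + 1) * ‖iteratedFDeriv ℝ k (W s) y‖ ≤ K) →
      (∀ ε : ℝ, 0 < ε → ∀ (R : ℝ) (N : ℕ), ∃ n : ℕ, N ≤ n ∧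
        ∀ s ∈ Icc (-R) R, ∀ y ∈ Metric.closedBall (0 : EuclideanSpace ℝ (Fin 3)) R,
          ‖W (s + n) y - W s y‖ < ε) →
      ∀ s y, W s y = 0) ↔
    (∀ (W : ℝ → EuclideanSpace ℝ (Fin 3) → EuclideanSpace ℝ (Fin 3)) (Q : ℝ → EuclideanSpace ℝ (Fin 3) → ℝ),
      IsBackwardLeraySolutionOn univ 1 W Q →
      (∀ k : ℕ, ∃ K : ℝ, ∀ s y, (1 + ‖y‖) ^ (k + 1) * ‖iteratedFDeriv ℝ k (W s) y‖ ≤ K) →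
      ∀ δ : ℝ, 0 < δ → ∃ s : ℝ, ∀ y, ‖W s y‖ < δ) := by
  constructor
  · intro hG'
    exact noTypeIProfile_of_noSelfExcitedDynamo (noSelfExcitedDynamo_of_noRecurrentTypeIProfile hG')
  · intro hG W Q hW hWprof hrec s y
    obtain ⟨ε₀, hε₀, hD⟩ := stub_singleTimeSwitchOff
    obtain ⟨s₀, hs₀⟩ := hG W Q hW hWprof ε₀ hε₀
    -- after the dip the flow is bounded by `2ε₀ e^{-(σ - s₀)/2}`
    have hdecay : ∀ σ, s₀ ≤ σ → ∀ y, ‖W σ y‖ ≤ 2 * ε₀ * Real.exp (-(σ - s₀) / 2) :=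
      hD W Q hW hWprof s₀ ε₀ le_rfl fun y => (hs₀ y).le
    -- `‖W s y‖` is smaller than every `η > 0`
    refine norm_le_zero_iff.1 (le_of_forall_pos_le_add fun η hη => ?_)
    rw [zero_add]
    -- the radius and the decay threshold
    set R : ℝ := max |s| ‖y‖ with hR
    have hsR : s ∈ Icc (-R) R := ⟨by rw [hR]; linarith [neg_abs_le s, le_max_left |s| ‖y‖],
      (le_abs_self s).trans (le_max_left _ _)⟩
    have hyR : y ∈ Metric.closedBall (0 : EuclideanSpace ℝ (Fin 3)) R := by
      rw [Metric.mem_closedBall, dist_zero_right]; exact le_max_right _ _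
    -- choose `N` with `s₀ ≤ s + N` and `2ε₀ e^{-(s+N-s₀)/2} ≤ η/2`
    obtain ⟨N, hN⟩ : ∃ N : ℕ, s₀ - s ≤ N ∧ 2 * ε₀ * Real.exp (-((N : ℝ) + s - s₀) / 2) ≤ η / 2 := by
      have h1 : Tendsto (fun n : ℕ => 2 * ε₀ * Real.exp (-((n : ℝ) + s - s₀) / 2)) atTop (𝓝 (2 * ε₀ * 0)) := by
        refine tendsto_const_nhds.mul ?_
        have hlin : Tendsto (fun n : ℕ => ((n : ℝ) + s - s₀) / 2) atTop atTop := by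
          have h0 : Tendsto (fun n : ℕ => (n : ℝ) + (s - s₀)) atTop atTop :=
            tendsto_atTop_add_const_right _ _ tendsto_natCast_atTop_atTop
          have h0' : Tendsto (fun n : ℕ => ((n : ℝ) + (s - s₀)) / 2) atTop atTop :=
            h0.atTop_div_const (by norm_num)
          refine h0'.congr fun n => ?_
          ring
        have h2 : Tendsto (fun n : ℕ => -(((n : ℝ) + s - s₀) / 2)) atTop atBot :=
          tendsto_neg_atTop_atBot.comp hlin
        have h3 := Real.tendsto_exp_atBot.comp h2
        refine h3.congr fun n => ?_
        simp only [Function.comp_apply, neg_div]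
      rw [mul_zero] at h1
      have h2 : ∀ᶠ n : ℕ in atTop, 2 * ε₀ * Real.exp (-((n : ℝ) + s - s₀) / 2) ≤ η / 2 :=
        (h1.eventually (eventually_le_nhds (by linarith : (0 : ℝ) < η / 2)))
      have h3 : ∀ᶠ n : ℕ in atTop, s₀ - s ≤ (n : ℝ) := tendsto_natCast_atTop_atTop.eventually_ge_atTop _
      exact (h3.and h2).exists
    obtain ⟨n, hn, hclose⟩ := hrec (η / 2) (by linarith) R N
    have hclose' := hclose s hsR y hyR
    have hσ : s₀ ≤ s + n := by
      have : (N : ℝ) ≤ n := by exact_mod_cast hn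
      linarith [hN.1]
    have hsmall : ‖W (s + n) y‖ ≤ η / 2 := by
      refine (hdecay (s + n) hσ y).trans ?_
      refine le_trans ?_ hN.2
      have : -((s + n) - s₀) / 2 ≤ -((N : ℝ) + s - s₀) / 2 := by
        have : (N : ℝ) ≤ n := by exact_mod_cast hn
        linarith
      exact mul_le_mul_of_nonneg_left (Real.exp_le_exp.2 this) (by linarith)
    calc ‖W s y‖ = ‖W (s + n) y - (W (s + n) y - W s y)‖ := by rw [sub_sub_cancel]
      _ ≤ ‖W (s + n) y‖ + ‖W (s + n) y - W s y‖ := norm_sub_le _ _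
      _ ≤ η / 2 + η / 2 := add_le_add hsmall hclose'.le
      _ = η := by ring

end Summit.NavierStokesRegularity.NavierStokesRegularity.Theorems.NoSelfExcitedDynamo.Registered

end
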